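import Mathlib
import Literature.Analysis.Complex.CauchyPompeiu
import HarnessLib

/-!
# The normal coordinate of a second `J`-holomorphic sheet satisfies `|∂̄ c| ≤ M |c|`

The scalar reduction behind positivity of intersections of `J`-holomorphic curves in dimension
four (McDuff–Salamon (2012), §2.4 and App. E; Wendl (2020), App. B, proof of Thm B.20 ⇒ B.37/B.39;
McDuff (1991), §2): read a second `J`-holomorphic sheet in a chart `E : ℂ × ℂ → F` that is
`J`-complex-linear along the first sheet `{w = 0}`; then its normal coordinate `c` satisfies a
linear Cauchy–Riemann inequality `‖∂̄ c‖ ≤ M ‖c‖`, to which the similarity principle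
(`Literature/Analysis/Complex/SimilarityPrinciple.lean`) applies: zeros of `c` (= intersections
with the first sheet) are isolated of positive index or `c ≡ 0`.

* `sheetDbarInequality` — Let `E : ℂ × ℂ → F` be smooth into a real normed space `F` carrying a
  smooth field of operators `J`, with `J (E (ζ,0)) ∘ dE_{(ζ,0)} = dE_{(ζ,0)} ∘ (i ⊕ i)` along
  `{w = 0}` and `dE` uniformly bounded below on a ball `B((ξ₁,0), r)`; let `γ = (a, c)` be a
  smooth curve in that ball on `B(ζ₂, ρ₀)` such that `E ∘ γ` is `J`-holomorphic
  (`d(E∘γ)(iθ) = J (d(E∘γ) θ)`). Then `‖∂̄ c‖ ≤ M ‖c‖` on a smaller closed disc about `ζ₂`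
  (`∂̄ = Literature.Analysis.Complex.dbarAlong 1`).
* `sheetDbarInequality_graph` — the graph case `a ζ = ζ`.

Proof: the defect `Δ(p) := J (E p) ∘ dE_p - dE_p ∘ (i ⊕ i)` is a `C¹` operator-valued map
vanishing on `{w = 0}`, hence `‖Δ(z, w)‖ ≤ C ‖w‖` on the ball by the mean value inequality
(`SheetDbar.norm_le_mul_norm_snd_of_vanish`). The chain rule and `J`-holomorphicity of `E ∘ γ`
give `dE_{γ ζ} (γ'(i θ) - (i ⊕ i) γ'(θ)) = Δ(γ ζ) γ'(θ)`, so the lower bound on `dE` yields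
`‖γ'(i) - (i ⊕ i) γ'(1)‖ ≤ B C ‖c ζ‖ ‖γ'(1)‖`; the second component of the left-hand side is
`dc(i) - i dc(1)`, of norm `2 ‖∂̄ c‖`, and `‖γ'(1)‖` is bounded on compact sub-discs. No
dimension restriction is needed for this step (it is stated for any real normed space `F`; the
consumers take `F = ℝ⁴`).

Provenance: first written (for `F = ℝ⁴`) for the crux `TameOrBrodyR4` of summit `SmoothPoincare4`
(`Theorems/SullivanDualTameOrBrodyR4HelperSheetDbarInequality.lean`), re-homed and generalised here
(promotion event 3639839); step W2 of the Literature proof of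
`Literature.Geometry.Symplectic.jHolomorphicLimitOfEmbedded_isEmbedded` (McDuff 1991 §4).

## References

* D. McDuff, D. Salamon, *J-holomorphic curves and symplectic topology*, 2nd ed. (2012), §2.4,
  App. E. [McDuffSalamon2012]
* C. Wendl, *Lectures on Contact 3-Manifolds, Holomorphic Curves and Intersection Theory* (2020),
  App. B. [Wendl2020]
* D. McDuff, *The local behaviour of holomorphic curves in almost complex 4-manifolds*,
  J. Differential Geom. 34 (1991), §2. [McDuff1991LocalBehaviour]
-/

noncomputable section

open Filter Set Metric
open scoped ContDiff Topology

namespace Literature.Geometry.Symplectic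

namespace SheetDbar

/-- A `C¹` map on `ℂ × ℂ` vanishing on `{w = 0}` is `O(‖w‖)` on every ball centred on `{w = 0}`
(mean value inequality with a derivative bound on the compact closed ball). [folklore] -/
theorem norm_le_mul_norm_snd_of_vanish {G : Type*} [NormedAddCommGroup G] [NormedSpace ℝ G]
    (f : ℂ × ℂ → G) (hf : ContDiff ℝ 1 f) (h0 : ∀ z : ℂ, f (z, 0) = 0) (ξ₁ : ℂ) (r : ℝ)
    (hr : 0 < r) :
    ∃ C : ℝ, 0 ≤ C ∧ ∀ p ∈ ball ((ξ₁, 0) : ℂ × ℂ) r, ‖f p‖ ≤ C * ‖p.2‖ := by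
  obtain ⟨C, hC⟩ := (isCompact_closedBall ((ξ₁, 0) : ℂ × ℂ) r).exists_bound_of_continuousOn
    (hf.continuous_fderiv one_ne_zero).continuousOn
  have hC0 : 0 ≤ C := (norm_nonneg _).trans (hC _ (mem_closedBall_self hr.le))
  refine ⟨C, hC0, fun p hp => ?_⟩
  have hp0 : ((p.1, 0) : ℂ × ℂ) ∈ ball ((ξ₁, 0) : ℂ × ℂ) r := by
    rw [mem_ball, Prod.dist_eq] at hp ⊢
    have h1 := lt_of_le_of_lt (le_max_left _ _) hp
    simpa using h1
  have key := (convex_ball ((ξ₁, 0) : ℂ × ℂ) r).norm_image_sub_le_of_norm_fderiv_le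
    (fun x _ => (hf.differentiable one_ne_zero) x)
    (fun x hx => hC x (ball_subset_closedBall hx)) hp0 hp
  rw [h0, sub_zero] at key
  have hn : ‖p - (p.1, 0)‖ = ‖p.2‖ := by
    obtain ⟨z, w⟩ := p
    simp
  rwa [hn] at key

/-- The algebraic identity behind `2 ∂̄ c = ∂ₓ c + i ∂_y c = i (∂_y c - i ∂ₓ c)` at the level of
norms. [folklore] -/
theorem norm_add_I_mul_eq (x y : ℂ) : ‖x + Complex.I * y‖ = ‖y - Complex.I * x‖ := by
  have h : x + Complex.I * y = Complex.I * (y - Complex.I * x) := by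
    linear_combination x * Complex.I_sq
  rw [h, norm_mul, Complex.norm_I, one_mul]

end SheetDbar

variable {F : Type*} [NormedAddCommGroup F] [NormedSpace ℝ F]

/-- **Scalar reduction: the normal coordinate `c` of a second `J`-holomorphic sheet, read in a
map `E` that is `J`-complex-linear along `{w = 0}`, satisfies `‖∂̄ c‖ ≤ M ‖c‖` near the point**
(McDuff–Salamon 2012, §2.4/App. E: intersections of `J`-curves ↔ zeros of a solution of a linear
Cauchy–Riemann inequality). Hypotheses: `J`, `E` smooth; `hhol`: `J ∘ dE = dE ∘ (i ⊕ i)` along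
`{w = 0}`; `hB`: `dE` bounded below by `1/B` on the ball `B((ξ₁,0), r)`; `γ = (a, c)` smooth on
`B(ζ₂, ρ₀)` with values in that ball and `E ∘ γ` `J`-holomorphic there. Conclusion: radii
`0 < ρ < ρ₀` and `M ≥ 0` with `‖∂̄ c ζ‖ ≤ M ‖c ζ‖` for `‖ζ - ζ₂‖ ≤ ρ`.
[cite: McDuffSalamon2012, §2.4 and App. E (reduction to the similarity principle)] -/
theorem sheetDbarInequality (J : F → F →L[ℝ] F) (hJs : ContDiff ℝ ∞ J)
    (E : ℂ × ℂ → F) (hE : ContDiff ℝ ∞ E) (ξ₁ : ℂ) (r B : ℝ) (hr : 0 < r)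
    (hhol : ∀ ζ α β : ℂ, J (E (ζ, 0)) (fderiv ℝ E (ζ, 0) (α, β)) =
      fderiv ℝ E (ζ, 0) (Complex.I * α, Complex.I * β))
    (hB : ∀ p ∈ ball ((ξ₁, 0) : ℂ × ℂ) r, ∀ q : ℂ × ℂ, ‖q‖ ≤ B * ‖fderiv ℝ E p q‖)
    (a c : ℂ → ℂ) (ζ₂ : ℂ) (ρ₀ : ℝ) (hρ₀ : 0 < ρ₀)
    (ha : ContDiffOn ℝ ∞ a (ball ζ₂ ρ₀)) (hc : ContDiffOn ℝ ∞ c (ball ζ₂ ρ₀))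
    (hin : ∀ ζ ∈ ball ζ₂ ρ₀, (a ζ, c ζ) ∈ ball ((ξ₁, 0) : ℂ × ℂ) r)
    (hJhol : ∀ ζ ∈ ball ζ₂ ρ₀, ∀ θ : ℂ,
      fderiv ℝ (fun ζ => E (a ζ, c ζ)) ζ (Complex.I * θ) =
        J (E (a ζ, c ζ)) (fderiv ℝ (fun ζ => E (a ζ, c ζ)) ζ θ)) :
    ∃ ρ M : ℝ, 0 < ρ ∧ ρ < ρ₀ ∧ 0 ≤ M ∧
      ∀ ζ ∈ closedBall ζ₂ ρ, ‖Literature.Analysis.Complex.dbarAlong 1 c ζ‖ ≤ M * ‖c ζ‖ := by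
  -- the operator `i ⊕ i` on `ℂ × ℂ`
  obtain ⟨Iop, hIop⟩ : ∃ Iop : ℂ × ℂ →L[ℝ] ℂ × ℂ,
      ∀ q : ℂ × ℂ, Iop q = (Complex.I * q.1, Complex.I * q.2) :=
    ⟨Complex.I • ContinuousLinearMap.id ℝ (ℂ × ℂ), fun q => by
      obtain ⟨α, β⟩ := q
      simp⟩
  -- the defect of `J`-complex-linearity of `dE`
  obtain ⟨Δ, hΔ⟩ : ∃ Δ : ℂ × ℂ → (ℂ × ℂ →L[ℝ] F),
      Δ = fun p => (J (E p)).comp (fderiv ℝ E p) - (fderiv ℝ E p).comp Iop := ⟨_, rfl⟩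
  have hD : ContDiff ℝ ∞ (fun p => fderiv ℝ E p) := (contDiff_infty_iff_fderiv.1 hE).2
  have hJE : ContDiff ℝ ∞ (fun p => J (E p)) := hJs.comp hE
  have hΔs : ContDiff ℝ 1 Δ := by
    rw [hΔ]
    exact ((hJE.clm_comp hD).sub (hD.clm_comp contDiff_const)).of_le (by simp)
  have hΔ0 : ∀ z : ℂ, Δ (z, 0) = 0 := by
    intro z
    rw [hΔ]
    refine ContinuousLinearMap.ext fun q => ?_
    obtain ⟨α, β⟩ := q
    simp only [sub_apply, ContinuousLinearMap.comp_apply, hIop, zero_apply, hhol, sub_self]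
  obtain ⟨C, hC0, hC⟩ := SheetDbar.norm_le_mul_norm_snd_of_vanish Δ hΔs hΔ0 ξ₁ r hr
  -- uniform bounds for `da`, `dc` on the closed half disc
  have hsub : closedBall ζ₂ (ρ₀ / 2) ⊆ ball ζ₂ ρ₀ := closedBall_subset_ball (by linarith)
  have hca : ContinuousOn (fderiv ℝ a) (ball ζ₂ ρ₀) :=
    ha.continuousOn_fderiv_of_isOpen isOpen_ball (by simp)
  have hcc : ContinuousOn (fderiv ℝ c) (ball ζ₂ ρ₀) :=
    hc.continuousOn_fderiv_of_isOpen isOpen_ball (by simp)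
  obtain ⟨Ga, hGa⟩ :=
    (isCompact_closedBall ζ₂ (ρ₀ / 2)).exists_bound_of_continuousOn (hca.mono hsub)
  obtain ⟨Gc, hGc⟩ :=
    (isCompact_closedBall ζ₂ (ρ₀ / 2)).exists_bound_of_continuousOn (hcc.mono hsub)
  have hGa0 : 0 ≤ Ga := (norm_nonneg _).trans (hGa ζ₂ (mem_closedBall_self (by linarith)))
  have hM0 : 0 ≤ max B 0 * C * max Ga Gc / 2 :=
    div_nonneg (mul_nonneg (mul_nonneg (le_max_right B 0) hC0) (hGa0.trans (le_max_left Ga Gc)))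
      zero_le_two
  refine ⟨ρ₀ / 2, max B 0 * C * max Ga Gc / 2, by linarith, by linarith, hM0, fun ζ hζ => ?_⟩
  have hζ' : ζ ∈ ball ζ₂ ρ₀ := hsub hζ
  -- chain rule for `E ∘ γ`, `γ = (a, c)`
  have hda : HasFDerivAt a (fderiv ℝ a ζ) ζ :=
    ((ha.contDiffAt (isOpen_ball.mem_nhds hζ')).differentiableAt (by simp)).hasFDerivAt
  have hdc : HasFDerivAt c (fderiv ℝ c ζ) ζ :=
    ((hc.contDiffAt (isOpen_ball.mem_nhds hζ')).differentiableAt (by simp)).hasFDerivAt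
  obtain ⟨γ', hγ'⟩ : ∃ γ' : ℂ →L[ℝ] ℂ × ℂ, γ' = (fderiv ℝ a ζ).prod (fderiv ℝ c ζ) := ⟨_, rfl⟩
  have hγ'ap : ∀ θ : ℂ, γ' θ = (fderiv ℝ a ζ θ, fderiv ℝ c ζ θ) := fun θ => by
    rw [hγ']
    rfl
  have hγ : HasFDerivAt (fun ζ => (a ζ, c ζ)) γ' ζ := hγ' ▸ hda.prodMk hdc
  have hEd : HasFDerivAt E (fderiv ℝ E (a ζ, c ζ)) (a ζ, c ζ) :=
    ((hE.differentiable (by simp)) _).hasFDerivAt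
  have hcomp : HasFDerivAt (fun ζ => E (a ζ, c ζ)) ((fderiv ℝ E (a ζ, c ζ)).comp γ') ζ :=
    hEd.comp ζ hγ
  have key := hJhol ζ hζ' 1
  rw [hcomp.fderiv, mul_one, ContinuousLinearMap.comp_apply, ContinuousLinearMap.comp_apply]
    at key
  -- the identity `dE (γ' i - (i ⊕ i) γ' 1) = Δ (γ ζ) (γ' 1)`
  have hΔap : J (E (a ζ, c ζ)) (fderiv ℝ E (a ζ, c ζ) (γ' 1)) =
      Δ (a ζ, c ζ) (γ' 1) + fderiv ℝ E (a ζ, c ζ) (Iop (γ' 1)) := by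
    rw [hΔ]
    simp
  have hdiff : fderiv ℝ E (a ζ, c ζ) (γ' Complex.I - Iop (γ' 1)) = Δ (a ζ, c ζ) (γ' 1) := by
    rw [map_sub, key, hΔap]
    abel
  -- lower bound on `dE` and the Lipschitz bound on `Δ`
  have h1 : ‖γ' Complex.I - Iop (γ' 1)‖ ≤ max B 0 * (C * ‖c ζ‖ * ‖γ' 1‖) := by
    calc ‖γ' Complex.I - Iop (γ' 1)‖
        ≤ B * ‖fderiv ℝ E (a ζ, c ζ) (γ' Complex.I - Iop (γ' 1))‖ := hB _ (hin ζ hζ') _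
      _ ≤ max B 0 * ‖fderiv ℝ E (a ζ, c ζ) (γ' Complex.I - Iop (γ' 1))‖ :=
          mul_le_mul_of_nonneg_right (le_max_left _ _) (norm_nonneg _)
      _ = max B 0 * ‖Δ (a ζ, c ζ) (γ' 1)‖ := by rw [hdiff]
      _ ≤ max B 0 * (C * ‖c ζ‖ * ‖γ' 1‖) := by
          apply mul_le_mul_of_nonneg_left _ (le_max_right _ _)
          calc ‖Δ (a ζ, c ζ) (γ' 1)‖ ≤ ‖Δ (a ζ, c ζ)‖ * ‖γ' 1‖ :=
                ContinuousLinearMap.le_opNorm _ _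
            _ ≤ C * ‖c ζ‖ * ‖γ' 1‖ :=
                mul_le_mul_of_nonneg_right (hC _ (hin ζ hζ')) (norm_nonneg _)
  -- the second component
  have h2 : ‖fderiv ℝ c ζ Complex.I - Complex.I * fderiv ℝ c ζ 1‖ ≤
      ‖γ' Complex.I - Iop (γ' 1)‖ := by
    have h : (γ' Complex.I - Iop (γ' 1)).2 =
        fderiv ℝ c ζ Complex.I - Complex.I * fderiv ℝ c ζ 1 := by
      rw [Prod.snd_sub, hIop, hγ'ap, hγ'ap]
    rw [← h]
    exact norm_snd_le _
  -- the bound on `γ' 1`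
  have h3 : ‖γ' 1‖ ≤ max Ga Gc := by
    rw [hγ'ap, Prod.norm_mk]
    exact max_le_max ((ContinuousLinearMap.unit_le_opNorm _ _ (by simp)).trans (hGa ζ hζ))
      ((ContinuousLinearMap.unit_le_opNorm _ _ (by simp)).trans (hGc ζ hζ))
  have h4 : ‖fderiv ℝ c ζ Complex.I - Complex.I * fderiv ℝ c ζ 1‖ ≤
      max B 0 * (C * ‖c ζ‖ * max Ga Gc) :=
    h2.trans (h1.trans (by gcongr))
  rw [Literature.Analysis.Complex.dbarAlong_one, norm_smul, smul_eq_mul,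
    SheetDbar.norm_add_I_mul_eq]
  have h5 : ‖(2 : ℂ)⁻¹‖ = 2⁻¹ := by simp
  rw [h5]
  calc 2⁻¹ * ‖fderiv ℝ c ζ Complex.I - Complex.I * fderiv ℝ c ζ 1‖
      ≤ 2⁻¹ * (max B 0 * (C * ‖c ζ‖ * max Ga Gc)) := by gcongr
    _ = max B 0 * C * max Ga Gc / 2 * ‖c ζ‖ := by ring

/-- **The graph case.** If the second sheet is a graph `ζ ↦ E (ζ, c ζ)` over the first (`a = id`),
the normal coordinate `c` satisfies `‖∂̄ c‖ ≤ M ‖c‖` near `ζ₂` under the same hypotheses on `E`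
and `J`. [cite: McDuffSalamon2012, §2.4 and App. E (reduction to the similarity principle)] -/
theorem sheetDbarInequality_graph (J : F → F →L[ℝ] F) (hJs : ContDiff ℝ ∞ J)
    (E : ℂ × ℂ → F) (hE : ContDiff ℝ ∞ E) (ξ₁ : ℂ) (r B : ℝ) (hr : 0 < r)
    (hhol : ∀ ζ α β : ℂ, J (E (ζ, 0)) (fderiv ℝ E (ζ, 0) (α, β)) =
      fderiv ℝ E (ζ, 0) (Complex.I * α, Complex.I * β))
    (hB : ∀ p ∈ ball ((ξ₁, 0) : ℂ × ℂ) r, ∀ q : ℂ × ℂ, ‖q‖ ≤ B * ‖fderiv ℝ E p q‖)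
    (c : ℂ → ℂ) (ζ₂ : ℂ) (ρ₀ : ℝ) (hρ₀ : 0 < ρ₀) (hc : ContDiffOn ℝ ∞ c (ball ζ₂ ρ₀))
    (hin : ∀ ζ ∈ ball ζ₂ ρ₀, (ζ, c ζ) ∈ ball ((ξ₁, 0) : ℂ × ℂ) r)
    (hJhol : ∀ ζ ∈ ball ζ₂ ρ₀, ∀ θ : ℂ,
      fderiv ℝ (fun ζ => E (ζ, c ζ)) ζ (Complex.I * θ) =
        J (E (ζ, c ζ)) (fderiv ℝ (fun ζ => E (ζ, c ζ)) ζ θ)) :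
    ∃ ρ M : ℝ, 0 < ρ ∧ ρ < ρ₀ ∧ 0 ≤ M ∧
      ∀ ζ ∈ closedBall ζ₂ ρ, ‖Literature.Analysis.Complex.dbarAlong 1 c ζ‖ ≤ M * ‖c ζ‖ :=
  sheetDbarInequality J hJs E hE ξ₁ r B hr hhol hB (fun ζ => ζ) c ζ₂ ρ₀ hρ₀
    contDiffOn_id hc hin hJhol

end Literature.Geometry.Symplectic

end
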